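import Literature.MathematicalPhysics.QuantumFieldTheory.Balaban1983to89.Node00.OpsYSectEStar
import Literature.MathematicalPhysics.QuantumFieldTheory.Balaban1983to89.Node00.OpsYRecordV4P

/-!
# `Balaban1983to89.Node00.OpsYSectEStarRecordP` — T. Bałaban, *Propagators for lattice gauge theories in a background field*, Commun. Math. Phys. **99**
# (1985) 389–434 [Balaban1985BackgroundPropagators], Thm 3.15 (3.156)–(3.158) p. 428, (3.185)–(3.187) p. 432, with the star convention of
# [Balaban1984PropagatorsII] (2.3) p. 224: THE TWO v4P INSTANCES OF RECORD AT STAR SECT. E LETTERS — `opsYStOfRecordV4PE`, `opsYNuStOfRecordV4PE`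

statement-level skeleton of published theorems with citation tags; proofs where landed; nothing here is a claim about the Yang–Mills mass gap

THE PRINT.  p. 428: *«C^{(k)}(Λ) = C C̃^{(k)}(Λ) C* (3.158)»* over the unit-lattice bonds `Λ* = T_1^Λ` of [Balaban1984PropagatorsII] (2.3) p. 224,
*«T_η^{Λ′} ⊂ Λ denotes the subset of all bonds with at least one ending point belonging to Λ′»* (`⊂`, not `⊂⊂`): the STAR sector `P_Λ^st = secΛstY`
(`Node00.OpsYSectEStar`, the bonds `inΛstY x` with at least one end block good).  p. 432: *«C^{(k)}(Λ) = (I + Dμ)QG̃₂Q*(I + μ*D*) (3.185) … the random walk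
expansion … (3.186) … |C^{(k)}(Λ; U, y, y′)| ≦ B₀ e^{−δ₀|y−y′|} (3.187)»*.

WHY THIS FILE (pub-ymgap bus 2026-08-29: def-Y WORD-L (a′) «STAR EDITION» I.45144; dag-n08-b g37 parts 1–2 `Node00.OpsYSectEStarGeometry` p689888 ∕
`Node00.OpsYSectEStar` p691829; def-Y g26 INTENT-66).  Part 2 typed the star Sect. E layer `operatorLayerYSectESt ∕ opsYSectESt` (generic in the base family
and the letters) and instantiated it at the v4 shape `opsYStOfRecordV4E` (base family `opsYS349OfRecordV4`, letters `lettersYOfRecordV4`).  The N06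
certificate of record (`Summit…BalabanUVNodesN06AtOpsYNuOfRecordV6EPairOT ∕ …OU`) elaborates against def-Y's OTHER record shape: the `ν`-read v4P instance
`opsYNuOfRecordV4PE N θ M⋆ 𝔯 𝔢 𝔴 𝔈` of `Node00.OpsYRecordV4P` — the v4 letters of record with their Sect. D∕E composites fed `G′_phys = η²·G′_latt`
(`lettersYOfRecordV4P`) under dag-n06-i's `ν`-read site-(3.49) layer `opsYS349NuOfLetters`.  This file is that record shape AT STAR SECT. E LETTERS, so the
certificate's star edition is the one substitution `opsYNuOfRecordV4PE ↦ opsYNuStOfRecordV4PE` (with `𝔢 : SectEStY`): every row other than 24 transports by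
the `rfl` faces below VERBATIM from the source instance (any source letters `𝔢'`), row 24 reads the STAR `C^{(k)}(Λ; U) = CkStY` and the star (3.185) slot.

WHAT THIS FILE DOES (two definitions + `rfl` ∕ `Iff.rfl` transport; the `OpsYRecordV4P` §4 faces name for name with `St` inserted):
* §0 the star update FORGETS an earlier Sect. E update: `operatorLayerYSectESt … (operatorLayerYSectE … ops 𝔏' 𝔢' 𝔴') 𝔏 𝔢 𝔴 = operatorLayerYSectESt … ops 𝔏 𝔢 𝔴`
  (`rfl`; family level `opsYSectESt_opsYSectE`; idem for two star updates);
* §1 ★★★ `opsYStOfRecordV4PE N θ M⋆ 𝔯 𝔢 𝔴 𝔈 := opsYSectESt … (opsYS349OfLetters … (lettersYOfRecordV4P … 𝔯) 𝔈) (lettersYOfRecordV4P … 𝔯) 𝔢 𝔴` and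
  ★★★ `opsYNuStOfRecordV4PE … := opsYSectESt … (opsYS349NuOfLetters … (lettersYOfRecordV4P … 𝔯) 𝔈) (lettersYOfRecordV4P … 𝔯) 𝔢 𝔴`;
* both ARE the star Sect. E update `opsYSectESt` of the SOURCE instances `opsYOfRecordV4PE ∕ opsYNuOfRecordV4PE` at any source letters (`_eq_opsYSectESt`, `rfl`);
* `_apply`; `_letters` (rows 17, 20–23, 26, 25 and the walk slot = the source instance's, `rfl`, for ANY source Sect. E family `𝔢'`); the two (3.132) kernels
  of the `ν`-read instance unfolded (`_QGQinv_QG1Qinv`); `_sectE` (row 24's `Ck = CkStY`-reading, `GivenBy3185 = givenBy3185stY`, `HasRWExpC = hasRWExpCY`,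
  `P349`; plain = `ν`-read on these); `_preds`; the [B9] bundles `Y9OfRecord_…`; the flat guard `_Ck_ker_flat`; ★ `t315_opsYNuStOfRecordV4PE_iff` (`Iff.rfl`,
  the named binder a certificate displays for row 24) and `t315_opsYStOfRecordV4PE_iff`; the honesty guards `t315_…_flat`.

HONEST SCOPE.  Definitions and `rfl` bookkeeping; no inequality of the paper is proved or asserted; the genuine star letters of record (`Λ̃ ∕ C ∕ C*` over
the averaged fields, part 3 `Node00.OpsYSectEElimStar`) enter through the parameter `𝔢 : SectEStY`; WHICH record a certificate elaborates against is the
certificate's edition.  Nothing landed is modified; N06 ∕ N08 are NOT discharged; NOT continuum, NOT OS, NOT the mass gap.  Filed by the pub-ymgap def-Y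
owner lineage (`pub-ymgap-node00-def-Y`, gen 26).  Net new unproved facts: 0.
-/

noncomputable section

namespace Literature.MathematicalPhysics.QuantumFieldTheory.Balaban1983to89.Node00

open B6KLevelCensusIndexV1 (KIdx)
open B9PinMembersKLevelV1 (MemberY geo9Y bg9Y)
open B9PinCarriersKLevelV1 (OperatorLayerY carriersY)
open B9PinGeometryKLevelV1 (inΛY unitDistY c35Y)
open B7Prop2SpecialUnitary (specialUnitaryUnits)
open B9Eq3132SectDLetters (QGQinvY)
open B9Ineq349SiteReading (p349SiteY fineKernelOfSiteOp opsYS349OfLetters)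
open B9Eq3132NuReading (siteKernelOfOpNu nuY opsYS349NuOfLetters)
open scoped Matrix

variable {d ℓ : ℕ} {hd : 1 ≤ d + 1} {hL : Odd (ℓ + 1) ∧ 1 < ℓ + 1} {b₀ b₁ : ℝ} {Mstar : ℕ}

variable {𝔸 : Type} [NormedRing 𝔸] [NormedAlgebra ℂ 𝔸] [CompleteSpace 𝔸]

/-! ## §0 The star update FORGETS an earlier source Sect. E update (it overwrites exactly `Ck ∕ GivenBy3185 ∕ HasRWExpC`) -/

section Forget

variable {G : Subgroup 𝔸ˣ} {x : MemberY d ℓ hd hL b₀ b₁ Mstar} (ops : OperatorLayerY d ℓ hd hL b₀ b₁ Mstar 𝔸 G x)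
  (𝔏' : CovLettersY 𝔸 x) (𝔢' : SectELettersY 𝔸 x) (𝔴' : RWLettersEY 𝔸 G x) (𝔏 : CovLettersY 𝔸 x) (𝔢 : SectELettersStY 𝔸 x) (𝔴 : RWLettersEY 𝔸 G x)

/-- ★ the star Sect. E update of a SOURCE-updated layer is the star update of the base layer (the three Sect. E fields are overwritten, every other field is
`ops`'s either way). [cite: Balaban1985BackgroundPropagators, Thm 3.15 (3.185)–(3.187) p.432, bookkeeping] -/
theorem operatorLayerYSectESt_operatorLayerYSectE :
    operatorLayerYSectESt 𝔸 G x (operatorLayerYSectE 𝔸 G x ops 𝔏' 𝔢' 𝔴') 𝔏 𝔢 𝔴 = operatorLayerYSectESt 𝔸 G x ops 𝔏 𝔢 𝔴 := rfl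

/-- … and two star updates collapse to the last one. [cite: Balaban1985BackgroundPropagators, Thm 3.15 p.432, bookkeeping] -/
theorem operatorLayerYSectESt_operatorLayerYSectESt (𝔢'' : SectELettersStY 𝔸 x) :
    operatorLayerYSectESt 𝔸 G x (operatorLayerYSectESt 𝔸 G x ops 𝔏' 𝔢'' 𝔴') 𝔏 𝔢 𝔴 = operatorLayerYSectESt 𝔸 G x ops 𝔏 𝔢 𝔴 := rfl

end Forget

section ForgetRecord

open scoped Matrix.Norms.L2Operator

variable (N : ℕ) (θ : Stage3Params) (Mstar : ℕ) (ops : OpsY N θ Mstar) (𝔏' : LettersY N θ Mstar) (𝔢' : SectEY N θ Mstar) (𝔴' : RWEY N θ Mstar)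
  (𝔏 : LettersY N θ Mstar) (𝔢 : SectEStY N θ Mstar) (𝔴 : RWEY N θ Mstar)

/-- ★ family level: `opsYSectESt` of a SOURCE-updated family `opsYSectE … ops 𝔏' 𝔢' 𝔴'` is `opsYSectESt` of the base family `ops`.
[cite: Balaban1985BackgroundPropagators, Thm 3.15 (3.185)–(3.187) p.432, bookkeeping] -/
theorem opsYSectESt_opsYSectE : opsYSectESt N θ Mstar (opsYSectE N θ Mstar ops 𝔏' 𝔢' 𝔴') 𝔏 𝔢 𝔴 = opsYSectESt N θ Mstar ops 𝔏 𝔢 𝔴 :=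
  funext fun x => operatorLayerYSectESt_operatorLayerYSectE (ops x) (𝔏' x) (𝔢' x) (𝔴' x) (𝔏 x) (𝔢 x) (𝔴 x)

/-- family level: two star updates collapse to the last one. [cite: Balaban1985BackgroundPropagators, Thm 3.15 p.432, bookkeeping] -/
theorem opsYSectESt_opsYSectESt (𝔢'' : SectEStY N θ Mstar) :
    opsYSectESt N θ Mstar (opsYSectESt N θ Mstar ops 𝔏' 𝔢'' 𝔴') 𝔏 𝔢 𝔴 = opsYSectESt N θ Mstar ops 𝔏 𝔢 𝔴 :=
  funext fun x => operatorLayerYSectESt_operatorLayerYSectESt (ops x) (𝔏' x) (𝔴' x) (𝔏 x) (𝔢 x) (𝔴 x) (𝔢'' x)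

end ForgetRecord

/-! ## §1 ★★ AT THE RECORD: the two v4P instances at STAR Sect. E letters and their `rfl` faces -/

section Record

open scoped Matrix.Norms.L2Operator

/-- ★★★ **THE v4P INSTANCE OF RECORD AT STAR SECT. E LETTERS**: the star Sect.-E constructor `opsYSectESt` over dag-n06-i's site-(3.49) layer, BOTH at the v4P
letters of record `lettersYOfRecordV4P … 𝔯` (Sect. D∕E composites fed `G′_phys`) — def-Y's `opsYOfRecordV4PE` with the STAR `C^{(k)}(Λ; U)` (3.156)–(3.158) and
the star (3.185) slot over `𝔢 : SectEStY`. [cite: Balaban1985BackgroundPropagators, Thms 3.1–3.15 pp.397–432, (3.156)–(3.158) p.428; Balaban1984PropagatorsII, (2.3) p.224] -/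
def opsYStOfRecordV4PE (N : ℕ) (θ : Stage3Params) (Mstar : ℕ) (𝔯 : ResY N θ Mstar) (𝔢 : SectEStY N θ Mstar) (𝔴 : RWEY N θ Mstar)
    (𝔈 : ExpsY N θ Mstar) : OpsY N θ Mstar :=
  opsYSectESt N θ Mstar (opsYS349OfLetters N θ Mstar (lettersYOfRecordV4P N θ Mstar 𝔯) 𝔈) (lettersYOfRecordV4P N θ Mstar 𝔯) 𝔢 𝔴

/-- ★★★ **THE v4P INSTANCE OF RECORD WITH ROW 26 `ν`-READ, AT STAR SECT. E LETTERS**: `opsYSectESt … (opsYS349NuOfLetters … 𝔏⁺ 𝔈) 𝔏⁺ 𝔢 𝔴` at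
`𝔏⁺ := lettersYOfRecordV4P … 𝔯` — def-Y's `opsYNuOfRecordV4PE` (the shape the N06 certificate of record reads) with the STAR `C^{(k)}(Λ; U)` and (3.185) slot.
[cite: Balaban1985BackgroundPropagators, Thms 3.1–3.15 pp.397–432, (3.132) p.422, (3.156)–(3.158) p.428; Balaban1984PropagatorsII, (2.3) p.224] -/
def opsYNuStOfRecordV4PE (N : ℕ) (θ : Stage3Params) (Mstar : ℕ) (𝔯 : ResY N θ Mstar) (𝔢 : SectEStY N θ Mstar) (𝔴 : RWEY N θ Mstar)
    (𝔈 : ExpsY N θ Mstar) : OpsY N θ Mstar :=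
  opsYSectESt N θ Mstar (opsYS349NuOfLetters N θ Mstar (lettersYOfRecordV4P N θ Mstar 𝔯) 𝔈) (lettersYOfRecordV4P N θ Mstar 𝔯) 𝔢 𝔴

variable (N : ℕ) (θ : Stage3Params) (Mstar : ℕ) (𝔯 : ResY N θ Mstar) (𝔢 : SectEStY N θ Mstar) (𝔴 : RWEY N θ Mstar) (𝔈 : ExpsY N θ Mstar)

/-! ### The two star instances ARE the star Sect. E update of the source instances of record -/

/-- ★ the star v4P instance IS the star Sect. E update `opsYSectESt` of def-Y's SOURCE v4P instance `opsYOfRecordV4PE` at ANY source Sect. E family `𝔢'`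
(the update overwrites exactly `Ck ∕ GivenBy3185 ∕ HasRWExpC`). [cite: Balaban1985BackgroundPropagators, Thm 3.15 p.432, bookkeeping] -/
theorem opsYStOfRecordV4PE_eq_opsYSectESt (𝔢' : SectEY N θ Mstar) (𝔴' : RWEY N θ Mstar) :
    opsYStOfRecordV4PE N θ Mstar 𝔯 𝔢 𝔴 𝔈 =
      opsYSectESt N θ Mstar (opsYOfRecordV4PE N θ Mstar 𝔯 𝔢' 𝔴' 𝔈) (lettersYOfRecordV4P N θ Mstar 𝔯) 𝔢 𝔴 :=
  (opsYSectESt_opsYSectE N θ Mstar (opsYS349OfLetters N θ Mstar (lettersYOfRecordV4P N θ Mstar 𝔯) 𝔈) (lettersYOfRecordV4P N θ Mstar 𝔯) 𝔢' 𝔴'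
    (lettersYOfRecordV4P N θ Mstar 𝔯) 𝔢 𝔴).symm

/-- ★ the `ν`-read star v4P instance IS the star Sect. E update `opsYSectESt` of def-Y's SOURCE `ν`-read v4P instance `opsYNuOfRecordV4PE` at ANY source Sect. E
family `𝔢'` — the one-substitution bridge for a certificate elaborated against `opsYNuOfRecordV4PE`. [cite: Balaban1985BackgroundPropagators, Thm 3.15 p.432, bookkeeping] -/
theorem opsYNuStOfRecordV4PE_eq_opsYSectESt (𝔢' : SectEY N θ Mstar) (𝔴' : RWEY N θ Mstar) :
    opsYNuStOfRecordV4PE N θ Mstar 𝔯 𝔢 𝔴 𝔈 =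
      opsYSectESt N θ Mstar (opsYNuOfRecordV4PE N θ Mstar 𝔯 𝔢' 𝔴' 𝔈) (lettersYOfRecordV4P N θ Mstar 𝔯) 𝔢 𝔴 :=
  (opsYSectESt_opsYSectE N θ Mstar (opsYS349NuOfLetters N θ Mstar (lettersYOfRecordV4P N θ Mstar 𝔯) 𝔈) (lettersYOfRecordV4P N θ Mstar 𝔯) 𝔢' 𝔴'
    (lettersYOfRecordV4P N θ Mstar 𝔯) 𝔢 𝔴).symm

/-! ### The two instances, unfolded field by field (`rfl` transport for the certificate's rows) -/

/-- the star v4P instance of record at a member, unfolded. [cite: Balaban1985BackgroundPropagators, Thm 3.15 p.432, bookkeeping] -/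
theorem opsYStOfRecordV4PE_apply (x : MemberY θ.d₆ θ.ℓ₆ θ.hd' θ.hL' θ.b₀ θ.b₁ Mstar) :
    opsYStOfRecordV4PE N θ Mstar 𝔯 𝔢 𝔴 𝔈 x =
      operatorLayerYSectESt (Matrix (Fin N) (Fin N) ℂ) (specialUnitaryUnits (Fin N)) x
        (opsYS349OfLetters N θ Mstar (lettersYOfRecordV4P N θ Mstar 𝔯) 𝔈 x) (lettersYOfRecordV4P N θ Mstar 𝔯 x) (𝔢 x) (𝔴 x) := rfl

/-- the `ν`-read star v4P instance of record at a member, unfolded. [cite: Balaban1985BackgroundPropagators, Thm 3.15 p.432, (3.132) p.422, bookkeeping] -/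
theorem opsYNuStOfRecordV4PE_apply (x : MemberY θ.d₆ θ.ℓ₆ θ.hd' θ.hL' θ.b₀ θ.b₁ Mstar) :
    opsYNuStOfRecordV4PE N θ Mstar 𝔯 𝔢 𝔴 𝔈 x =
      operatorLayerYSectESt (Matrix (Fin N) (Fin N) ℂ) (specialUnitaryUnits (Fin N)) x
        (opsYS349NuOfLetters N θ Mstar (lettersYOfRecordV4P N θ Mstar 𝔯) 𝔈 x) (lettersYOfRecordV4P N θ Mstar 𝔯 x) (𝔢 x) (𝔴 x) := rfl

/-- ★ ROWS 17, 20–23, 25, 26 and the walk slot: the operator-kernel fields of the plain star v4P instance ARE those of def-Y's SOURCE instance `opsYOfRecordV4PE`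
at ANY source Sect. E family `𝔢'` (hence def-Y's base readings `opsYOfLetters` of the v4P letters of record, `opsYOfRecordV4PE_letters`).
[cite: Balaban1985BackgroundPropagators, Thms 3.1–3.14 pp.397–427, (3.49) p.399, bookkeeping] -/
theorem opsYStOfRecordV4PE_letters (x : MemberY θ.d₆ θ.ℓ₆ θ.hd' θ.hL' θ.b₀ θ.b₁ Mstar) (𝔢' : SectEY N θ Mstar) :
    (opsYStOfRecordV4PE N θ Mstar 𝔯 𝔢 𝔴 𝔈 x).Gp = (opsYOfRecordV4PE N θ Mstar 𝔯 𝔢' 𝔴 𝔈 x).Gp ∧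
      (opsYStOfRecordV4PE N θ Mstar 𝔯 𝔢 𝔴 𝔈 x).GA = (opsYOfRecordV4PE N θ Mstar 𝔯 𝔢' 𝔴 𝔈 x).GA ∧
      (opsYStOfRecordV4PE N θ Mstar 𝔯 𝔢 𝔴 𝔈 x).Cinv = (opsYOfRecordV4PE N θ Mstar 𝔯 𝔢' 𝔴 𝔈 x).Cinv ∧
      (opsYStOfRecordV4PE N θ Mstar 𝔯 𝔢 𝔴 𝔈 x).GD = (opsYOfRecordV4PE N θ Mstar 𝔯 𝔢' 𝔴 𝔈 x).GD ∧
      (opsYStOfRecordV4PE N θ Mstar 𝔯 𝔢 𝔴 𝔈 x).G₁ = (opsYOfRecordV4PE N θ Mstar 𝔯 𝔢' 𝔴 𝔈 x).G₁ ∧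
      (opsYStOfRecordV4PE N θ Mstar 𝔯 𝔢 𝔴 𝔈 x).H = (opsYOfRecordV4PE N θ Mstar 𝔯 𝔢' 𝔴 𝔈 x).H ∧
      (opsYStOfRecordV4PE N θ Mstar 𝔯 𝔢 𝔴 𝔈 x).H₁ = (opsYOfRecordV4PE N θ Mstar 𝔯 𝔢' 𝔴 𝔈 x).H₁ ∧
      (opsYStOfRecordV4PE N θ Mstar 𝔯 𝔢 𝔴 𝔈 x).GG = (opsYOfRecordV4PE N θ Mstar 𝔯 𝔢' 𝔴 𝔈 x).GG ∧
      (opsYStOfRecordV4PE N θ Mstar 𝔯 𝔢 𝔴 𝔈 x).Kdiff = (opsYOfRecordV4PE N θ Mstar 𝔯 𝔢' 𝔴 𝔈 x).Kdiff ∧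
      (opsYStOfRecordV4PE N θ Mstar 𝔯 𝔢 𝔴 𝔈 x).QGQinv = (opsYOfRecordV4PE N θ Mstar 𝔯 𝔢' 𝔴 𝔈 x).QGQinv ∧
      (opsYStOfRecordV4PE N θ Mstar 𝔯 𝔢 𝔴 𝔈 x).QG1Qinv = (opsYOfRecordV4PE N θ Mstar 𝔯 𝔢' 𝔴 𝔈 x).QG1Qinv ∧
      (opsYStOfRecordV4PE N θ Mstar 𝔯 𝔢 𝔴 𝔈 x).P349 = (opsYOfRecordV4PE N θ Mstar 𝔯 𝔢' 𝔴 𝔈 x).P349 ∧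
      (opsYStOfRecordV4PE N θ Mstar 𝔯 𝔢 𝔴 𝔈 x).HasRWExpC = (opsYOfRecordV4PE N θ Mstar 𝔯 𝔢' 𝔴 𝔈 x).HasRWExpC :=
  ⟨rfl, rfl, rfl, rfl, rfl, rfl, rfl, rfl, rfl, rfl, rfl, rfl, rfl⟩

/-- ★ ROWS 17, 20–23, 25, 26 and the walk slot: the operator-kernel fields of the `ν`-read star v4P instance ARE those of def-Y's SOURCE `ν`-read instance
`opsYNuOfRecordV4PE` at ANY source Sect. E family `𝔢'` — in particular the two (3.132) kernels are the `ν`-readings FED `G′_phys` (`opsYNuOfRecordV4PE_QGQinv_QG1Qinv`).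
[cite: Balaban1985BackgroundPropagators, Thms 3.1–3.14 pp.397–427, (3.132) p.422, (3.49) p.399, bookkeeping] -/
theorem opsYNuStOfRecordV4PE_letters (x : MemberY θ.d₆ θ.ℓ₆ θ.hd' θ.hL' θ.b₀ θ.b₁ Mstar) (𝔢' : SectEY N θ Mstar) :
    (opsYNuStOfRecordV4PE N θ Mstar 𝔯 𝔢 𝔴 𝔈 x).Gp = (opsYNuOfRecordV4PE N θ Mstar 𝔯 𝔢' 𝔴 𝔈 x).Gp ∧
      (opsYNuStOfRecordV4PE N θ Mstar 𝔯 𝔢 𝔴 𝔈 x).GA = (opsYNuOfRecordV4PE N θ Mstar 𝔯 𝔢' 𝔴 𝔈 x).GA ∧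
      (opsYNuStOfRecordV4PE N θ Mstar 𝔯 𝔢 𝔴 𝔈 x).Cinv = (opsYNuOfRecordV4PE N θ Mstar 𝔯 𝔢' 𝔴 𝔈 x).Cinv ∧
      (opsYNuStOfRecordV4PE N θ Mstar 𝔯 𝔢 𝔴 𝔈 x).GD = (opsYNuOfRecordV4PE N θ Mstar 𝔯 𝔢' 𝔴 𝔈 x).GD ∧
      (opsYNuStOfRecordV4PE N θ Mstar 𝔯 𝔢 𝔴 𝔈 x).G₁ = (opsYNuOfRecordV4PE N θ Mstar 𝔯 𝔢' 𝔴 𝔈 x).G₁ ∧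
      (opsYNuStOfRecordV4PE N θ Mstar 𝔯 𝔢 𝔴 𝔈 x).H = (opsYNuOfRecordV4PE N θ Mstar 𝔯 𝔢' 𝔴 𝔈 x).H ∧
      (opsYNuStOfRecordV4PE N θ Mstar 𝔯 𝔢 𝔴 𝔈 x).H₁ = (opsYNuOfRecordV4PE N θ Mstar 𝔯 𝔢' 𝔴 𝔈 x).H₁ ∧
      (opsYNuStOfRecordV4PE N θ Mstar 𝔯 𝔢 𝔴 𝔈 x).GG = (opsYNuOfRecordV4PE N θ Mstar 𝔯 𝔢' 𝔴 𝔈 x).GG ∧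
      (opsYNuStOfRecordV4PE N θ Mstar 𝔯 𝔢 𝔴 𝔈 x).Kdiff = (opsYNuOfRecordV4PE N θ Mstar 𝔯 𝔢' 𝔴 𝔈 x).Kdiff ∧
      (opsYNuStOfRecordV4PE N θ Mstar 𝔯 𝔢 𝔴 𝔈 x).QGQinv = (opsYNuOfRecordV4PE N θ Mstar 𝔯 𝔢' 𝔴 𝔈 x).QGQinv ∧
      (opsYNuStOfRecordV4PE N θ Mstar 𝔯 𝔢 𝔴 𝔈 x).QG1Qinv = (opsYNuOfRecordV4PE N θ Mstar 𝔯 𝔢' 𝔴 𝔈 x).QG1Qinv ∧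
      (opsYNuStOfRecordV4PE N θ Mstar 𝔯 𝔢 𝔴 𝔈 x).P349 = (opsYNuOfRecordV4PE N θ Mstar 𝔯 𝔢' 𝔴 𝔈 x).P349 ∧
      (opsYNuStOfRecordV4PE N θ Mstar 𝔯 𝔢 𝔴 𝔈 x).HasRWExpC = (opsYNuOfRecordV4PE N θ Mstar 𝔯 𝔢' 𝔴 𝔈 x).HasRWExpC :=
  ⟨rfl, rfl, rfl, rfl, rfl, rfl, rfl, rfl, rfl, rfl, rfl, rfl, rfl⟩

/-- ★ ROW 26's two kernels at the `ν`-read star v4P instance ARE the `ν`-readings of the genuine `(QG̃Q*)⁻¹ ∕ (QG₁Q*)⁻¹` FED `G′_phys`.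
[cite: Balaban1985BackgroundPropagators, (3.132) p.422, (3.129) p.421, bookkeeping] -/
theorem opsYNuStOfRecordV4PE_QGQinv_QG1Qinv (x : MemberY θ.d₆ θ.ℓ₆ θ.hd' θ.hL' θ.b₀ θ.b₁ Mstar) :
    (opsYNuStOfRecordV4PE N θ Mstar 𝔯 𝔢 𝔴 𝔈 x).QGQinv =
        siteKernelOfOpNu x.toKIdx (bg9Y (Matrix (Fin N) (Fin N) ℂ) (specialUnitaryUnits (Fin N)) x) (fun U => U) (nuY (θ.d₆ + 1) x.toKIdx)
          (QGQinvY x.toKIdx (parSymY x.toKIdx) (parBY x.toKIdx) (GpPhysY x.toKIdx (parSymY x.toKIdx))) ∧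
      (opsYNuStOfRecordV4PE N θ Mstar 𝔯 𝔢 𝔴 𝔈 x).QG1Qinv =
        siteKernelOfOpNu x.toKIdx (bg9Y (Matrix (Fin N) (Fin N) ℂ) (specialUnitaryUnits (Fin N)) x) (fun U => U) (nuY (θ.d₆ + 1) x.toKIdx)
          (QG1QinvY x.toKIdx (parSymY x.toKIdx) (parBY x.toKIdx) (GpPhysY x.toKIdx (parSymY x.toKIdx)) (𝔯 x).Δ2) := ⟨rfl, rfl⟩

/-- ★ ROWS 24–25 at both star v4P instances: `Ck` = FILE 1's index-bond reading of the STAR `C^{(k)}(Λ; U) = CkStY` over the v4P letters of record and the star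
letters `𝔢 x`, `GivenBy3185 = givenBy3185stY`, `HasRWExpC = hasRWExpCY (𝔴 x)`, and `P349` = n06-i's site-(3.49) reading of the v4P letters (reads only `.Gp ∕ .parS`
— v4's); the plain and the `ν`-read instance agree on these four. [cite: Balaban1985BackgroundPropagators, Thm 3.15 (3.185)–(3.187) p.432, (3.158) p.428, (3.49) p.399, bookkeeping] -/
theorem opsYNuStOfRecordV4PE_sectE (x : MemberY θ.d₆ θ.ℓ₆ θ.hd' θ.hL' θ.b₀ θ.b₁ Mstar) :
    (opsYNuStOfRecordV4PE N θ Mstar 𝔯 𝔢 𝔴 𝔈 x).Ck =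
        siteKernelOfOp x.toKIdx (bg9Y (Matrix (Fin N) (Fin N) ℂ) (specialUnitaryUnits (Fin N)) x) (fun U => U)
          (CkStY x (lettersYOfRecordV4P N θ Mstar 𝔯 x) (𝔢 x)) id id ∧
      (opsYNuStOfRecordV4PE N θ Mstar 𝔯 𝔢 𝔴 𝔈 x).GivenBy3185 = givenBy3185stY x (lettersYOfRecordV4P N θ Mstar 𝔯 x) (𝔢 x) ∧
      (opsYNuStOfRecordV4PE N θ Mstar 𝔯 𝔢 𝔴 𝔈 x).HasRWExpC = hasRWExpCY (𝔴 x) ∧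
      (opsYNuStOfRecordV4PE N θ Mstar 𝔯 𝔢 𝔴 𝔈 x).P349 =
        p349SiteY (Matrix (Fin N) (Fin N) ℂ) (specialUnitaryUnits (Fin N)) x (lettersYOfRecordV4P N θ Mstar 𝔯 x) ∧
      (opsYNuStOfRecordV4PE N θ Mstar 𝔯 𝔢 𝔴 𝔈 x).P349 =
        fineKernelOfSiteOp x.toKIdx (bg9Y (Matrix (Fin N) (Fin N) ℂ) (specialUnitaryUnits (Fin N)) x) (fun U => U)
          (P349Y x.toKIdx (parSymY x.toKIdx) (GpY x.toKIdx (parSymY x.toKIdx))) ∧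
      (opsYStOfRecordV4PE N θ Mstar 𝔯 𝔢 𝔴 𝔈 x).Ck = (opsYNuStOfRecordV4PE N θ Mstar 𝔯 𝔢 𝔴 𝔈 x).Ck ∧
      (opsYStOfRecordV4PE N θ Mstar 𝔯 𝔢 𝔴 𝔈 x).GivenBy3185 = (opsYNuStOfRecordV4PE N θ Mstar 𝔯 𝔢 𝔴 𝔈 x).GivenBy3185 ∧
      (opsYStOfRecordV4PE N θ Mstar 𝔯 𝔢 𝔴 𝔈 x).HasRWExpC = (opsYNuStOfRecordV4PE N θ Mstar 𝔯 𝔢 𝔴 𝔈 x).HasRWExpC ∧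
      (opsYStOfRecordV4PE N θ Mstar 𝔯 𝔢 𝔴 𝔈 x).P349 = (opsYNuStOfRecordV4PE N θ Mstar 𝔯 𝔢 𝔴 𝔈 x).P349 :=
  ⟨rfl, rfl, rfl, rfl, rfl, rfl, rfl, rfl, rfl⟩

/-- ★ ROW 24's kernel ENTRY at the `ν`-read star v4P instance: the sup over the unit ball of the STAR `C^{(k)}(Λ; U)` applied to a bond delta.
[cite: Balaban1985BackgroundPropagators, Thm 3.15 (3.187) p.432, bookkeeping] -/
theorem opsYNuStOfRecordV4PE_Ck_ker (x : MemberY θ.d₆ θ.ℓ₆ θ.hd' θ.hL' θ.b₀ θ.b₁ Mstar)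
    (U : (bg9Y (Matrix (Fin N) (Fin N) ℂ) (specialUnitaryUnits (Fin N)) x).Cfg) (y y' : (geo9Y x).Site) :
    (opsYNuStOfRecordV4PE N θ Mstar 𝔯 𝔢 𝔴 𝔈 x).Ck.ker U y y' =
      ⨆ E : BallY (Matrix (Fin N) (Fin N) ℂ),
        ‖CkStY x (lettersYOfRecordV4P N θ Mstar 𝔯 x) (𝔢 x) U (deltaY y' (E : Matrix (Fin N) (Fin N) ℂ)) y‖ := rfl

/-- ★ the predicate ∕ expansion fields of both star v4P instances are `𝔈`'s (rows 1–3, 13–16, 18–19 transport by `rfl`).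
[cite: Balaban1985BackgroundPropagators, Thms 3.4–3.13 pp.400–426, bookkeeping] -/
theorem opsYNuStOfRecordV4PE_preds (x : MemberY θ.d₆ θ.ℓ₆ θ.hd' θ.hL' θ.b₀ θ.b₁ Mstar) :
    (opsYNuStOfRecordV4PE N θ Mstar 𝔯 𝔢 𝔴 𝔈 x).IsAnalyticExt = (𝔈 x).IsAnalyticExt ∧ (opsYNuStOfRecordV4PE N θ Mstar 𝔯 𝔢 𝔴 𝔈 x).E37 = (𝔈 x).E37 ∧
      (opsYNuStOfRecordV4PE N θ Mstar 𝔯 𝔢 𝔴 𝔈 x).EK39 = (𝔈 x).EK39 ∧ (opsYNuStOfRecordV4PE N θ Mstar 𝔯 𝔢 𝔴 𝔈 x).E310 = (𝔈 x).E310 ∧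
      (opsYNuStOfRecordV4PE N θ Mstar 𝔯 𝔢 𝔴 𝔈 x).PosDef = (𝔈 x).PosDef ∧ (opsYNuStOfRecordV4PE N θ Mstar 𝔯 𝔢 𝔴 𝔈 x).HasRWExp = (𝔈 x).HasRWExp ∧
      (opsYNuStOfRecordV4PE N θ Mstar 𝔯 𝔢 𝔴 𝔈 x).HasRWExpH = (𝔈 x).HasRWExpH ∧ (opsYNuStOfRecordV4PE N θ Mstar 𝔯 𝔢 𝔴 𝔈 x).PosDefK = (𝔈 x).PosDefK ∧
      (opsYStOfRecordV4PE N θ Mstar 𝔯 𝔢 𝔴 𝔈 x).IsAnalyticExt = (𝔈 x).IsAnalyticExt ∧ (opsYStOfRecordV4PE N θ Mstar 𝔯 𝔢 𝔴 𝔈 x).E37 = (𝔈 x).E37 ∧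
      (opsYStOfRecordV4PE N θ Mstar 𝔯 𝔢 𝔴 𝔈 x).EK39 = (𝔈 x).EK39 ∧ (opsYStOfRecordV4PE N θ Mstar 𝔯 𝔢 𝔴 𝔈 x).E310 = (𝔈 x).E310 ∧
      (opsYStOfRecordV4PE N θ Mstar 𝔯 𝔢 𝔴 𝔈 x).PosDef = (𝔈 x).PosDef ∧ (opsYStOfRecordV4PE N θ Mstar 𝔯 𝔢 𝔴 𝔈 x).HasRWExp = (𝔈 x).HasRWExp ∧
      (opsYStOfRecordV4PE N θ Mstar 𝔯 𝔢 𝔴 𝔈 x).HasRWExpH = (𝔈 x).HasRWExpH ∧ (opsYStOfRecordV4PE N θ Mstar 𝔯 𝔢 𝔴 𝔈 x).PosDefK = (𝔈 x).PosDefK :=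
  ⟨rfl, rfl, rfl, rfl, rfl, rfl, rfl, rfl, rfl, rfl, rfl, rfl, rfl, rfl, rfl, rfl⟩

/-- the [B9] bundle of record at the `ν`-read star v4P instance. [cite: Balaban1985BackgroundPropagators, Thms 3.1–3.15 pp.397–432, bookkeeping] -/
theorem Y9OfRecord_opsYNuStOfRecordV4PE :
    Y9OfRecord N θ Mstar (opsYNuStOfRecordV4PE N θ Mstar 𝔯 𝔢 𝔴 𝔈) =
      carriersY θ.d₆ θ.ℓ₆ θ.hd' θ.hL' θ.b₀ θ.b₁ Mstar (Matrix (Fin N) (Fin N) ℂ) (specialUnitaryUnits (Fin N)) (opsYNuStOfRecordV4PE N θ Mstar 𝔯 𝔢 𝔴 𝔈) :=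
  rfl

/-- the [B9] bundle of record at the plain star v4P instance. [cite: Balaban1985BackgroundPropagators, Thms 3.1–3.15 pp.397–432, bookkeeping] -/
theorem Y9OfRecord_opsYStOfRecordV4PE :
    Y9OfRecord N θ Mstar (opsYStOfRecordV4PE N θ Mstar 𝔯 𝔢 𝔴 𝔈) =
      carriersY θ.d₆ θ.ℓ₆ θ.hd' θ.hL' θ.b₀ θ.b₁ Mstar (Matrix (Fin N) (Fin N) ℂ) (specialUnitaryUnits (Fin N)) (opsYStOfRecordV4PE N θ Mstar 𝔯 𝔢 𝔴 𝔈) :=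
  rfl

/-- at the FLAT star Sect. E family the `ν`-read star v4P instance's `Ck` kernel vanishes identically (row 24's honesty guard, first half).
[cite: Balaban1985BackgroundPropagators, Thm 3.15 (3.187) p.432, bookkeeping] -/
theorem opsYNuStOfRecordV4PE_Ck_ker_flat (x : MemberY θ.d₆ θ.ℓ₆ θ.hd' θ.hL' θ.b₀ θ.b₁ Mstar)
    (U : (bg9Y (Matrix (Fin N) (Fin N) ℂ) (specialUnitaryUnits (Fin N)) x).Cfg) (y y' : (geo9Y x).Site) :
    (opsYNuStOfRecordV4PE N θ Mstar 𝔯 (sectEStY_flat N θ Mstar) 𝔴 𝔈 x).Ck.ker U y y' = 0 :=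
  operatorLayerYSectESt_Ck_ker_flat x (opsYS349NuOfLetters N θ Mstar (lettersYOfRecordV4P N θ Mstar 𝔯) 𝔈 x) (lettersYOfRecordV4P N θ Mstar 𝔯 x) (𝔴 x)
    U y y'

/-- at the FLAT star Sect. E family the plain star v4P instance's `Ck` kernel vanishes identically.
[cite: Balaban1985BackgroundPropagators, Thm 3.15 (3.187) p.432, bookkeeping] -/
theorem opsYStOfRecordV4PE_Ck_ker_flat (x : MemberY θ.d₆ θ.ℓ₆ θ.hd' θ.hL' θ.b₀ θ.b₁ Mstar)
    (U : (bg9Y (Matrix (Fin N) (Fin N) ℂ) (specialUnitaryUnits (Fin N)) x).Cfg) (y y' : (geo9Y x).Site) :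
    (opsYStOfRecordV4PE N θ Mstar 𝔯 (sectEStY_flat N θ Mstar) 𝔴 𝔈 x).Ck.ker U y y' = 0 :=
  operatorLayerYSectESt_Ck_ker_flat x (opsYS349OfLetters N θ Mstar (lettersYOfRecordV4P N θ Mstar 𝔯) 𝔈 x) (lettersYOfRecordV4P N θ Mstar 𝔯 x) (𝔴 x)
    U y y'

/-- ★ **ROW 24 (`t315`) AT THE `ν`-READ STAR v4P INSTANCE, UNFOLDED** (`Iff.rfl`) — the named binder a certificate displays for row 24: r1's `Thm315FullPrinted`
IS the printed Theorem 3.15 about the index-bond kernel of the STAR `C^{(k)}(Λ; U) = CkStY` over the v4P letters of record and the star letters `𝔢`, with «given by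
the formula (3.185)» = `givenBy3185stY` and the expansion clause = `hasRWExpCY (𝔴 x)` (kernel rows indexed by `inΛY` pairs, unchanged).
[cite: Balaban1985BackgroundPropagators, Thm 3.15 (3.185)–(3.187) p.432] -/
theorem t315_opsYNuStOfRecordV4PE_iff :
    B9.Thm315FullPrinted c35Y geo9Y (bg9Y (Matrix (Fin N) (Fin N) ℂ) (specialUnitaryUnits (Fin N)))
        (fun x => (opsYNuStOfRecordV4PE N θ Mstar 𝔯 𝔢 𝔴 𝔈 x).Ck) inΛY unitDistY
        (fun x => (opsYNuStOfRecordV4PE N θ Mstar 𝔯 𝔢 𝔴 𝔈 x).GivenBy3185) (fun x => (opsYNuStOfRecordV4PE N θ Mstar 𝔯 𝔢 𝔴 𝔈 x).HasRWExpC) ↔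
      B9.Thm315FullPrinted c35Y geo9Y (bg9Y (Matrix (Fin N) (Fin N) ℂ) (specialUnitaryUnits (Fin N)))
        (fun x => siteKernelOfOp x.toKIdx (bg9Y (Matrix (Fin N) (Fin N) ℂ) (specialUnitaryUnits (Fin N)) x) (fun U => U)
          (CkStY x (lettersYOfRecordV4P N θ Mstar 𝔯 x) (𝔢 x)) id id) inΛY unitDistY
        (fun x => givenBy3185stY x (lettersYOfRecordV4P N θ Mstar 𝔯 x) (𝔢 x)) (fun x => hasRWExpCY (𝔴 x)) := Iff.rfl

/-- ROW 24 (`t315`) at the plain star v4P instance, unfolded (`Iff.rfl`). [cite: Balaban1985BackgroundPropagators, Thm 3.15 (3.185)–(3.187) p.432] -/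
theorem t315_opsYStOfRecordV4PE_iff :
    B9.Thm315FullPrinted c35Y geo9Y (bg9Y (Matrix (Fin N) (Fin N) ℂ) (specialUnitaryUnits (Fin N)))
        (fun x => (opsYStOfRecordV4PE N θ Mstar 𝔯 𝔢 𝔴 𝔈 x).Ck) inΛY unitDistY
        (fun x => (opsYStOfRecordV4PE N θ Mstar 𝔯 𝔢 𝔴 𝔈 x).GivenBy3185) (fun x => (opsYStOfRecordV4PE N θ Mstar 𝔯 𝔢 𝔴 𝔈 x).HasRWExpC) ↔
      B9.Thm315FullPrinted c35Y geo9Y (bg9Y (Matrix (Fin N) (Fin N) ℂ) (specialUnitaryUnits (Fin N)))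
        (fun x => siteKernelOfOp x.toKIdx (bg9Y (Matrix (Fin N) (Fin N) ℂ) (specialUnitaryUnits (Fin N)) x) (fun U => U)
          (CkStY x (lettersYOfRecordV4P N θ Mstar 𝔯 x) (𝔢 x)) id id) inΛY unitDistY
        (fun x => givenBy3185stY x (lettersYOfRecordV4P N θ Mstar 𝔯 x) (𝔢 x)) (fun x => hasRWExpCY (𝔴 x)) := Iff.rfl

/-- ROW 24 at the plain star v4P instance IS row 24 at the `ν`-read one (the three Sect. E fields agree, `Iff.rfl`). [cite: Balaban1985BackgroundPropagators, Thm 3.15 p.432, bookkeeping] -/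
theorem t315_opsYStOfRecordV4PE_iff_nu :
    B9.Thm315FullPrinted c35Y geo9Y (bg9Y (Matrix (Fin N) (Fin N) ℂ) (specialUnitaryUnits (Fin N)))
        (fun x => (opsYStOfRecordV4PE N θ Mstar 𝔯 𝔢 𝔴 𝔈 x).Ck) inΛY unitDistY
        (fun x => (opsYStOfRecordV4PE N θ Mstar 𝔯 𝔢 𝔴 𝔈 x).GivenBy3185) (fun x => (opsYStOfRecordV4PE N θ Mstar 𝔯 𝔢 𝔴 𝔈 x).HasRWExpC) ↔
      B9.Thm315FullPrinted c35Y geo9Y (bg9Y (Matrix (Fin N) (Fin N) ℂ) (specialUnitaryUnits (Fin N)))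
        (fun x => (opsYNuStOfRecordV4PE N θ Mstar 𝔯 𝔢 𝔴 𝔈 x).Ck) inΛY unitDistY
        (fun x => (opsYNuStOfRecordV4PE N θ Mstar 𝔯 𝔢 𝔴 𝔈 x).GivenBy3185) (fun x => (opsYNuStOfRecordV4PE N θ Mstar 𝔯 𝔢 𝔴 𝔈 x).HasRWExpC) :=
  Iff.rfl

/-- THE HONESTY GUARD at star v4P: at the FLAT star Sect. E family and the FLAT walk letters row 24 holds OUTRIGHT at the `ν`-read star instance (kernel `0`, both
slots trivially inhabited) — content enters exactly with GENUINE star letters (part 3's record), never by the typing alone.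
[cite: Balaban1985BackgroundPropagators, Thm 3.15 (3.185)–(3.187) p.432, bookkeeping] -/
theorem t315_opsYNuStOfRecordV4PE_flat {δ₀ : ℝ} (hδ₀ : 0 < δ₀) :
    B9.Thm315FullPrinted c35Y geo9Y (bg9Y (Matrix (Fin N) (Fin N) ℂ) (specialUnitaryUnits (Fin N)))
      (fun x => (opsYNuStOfRecordV4PE N θ Mstar 𝔯 (sectEStY_flat N θ Mstar) (rwEY_flat N θ Mstar) 𝔈 x).Ck) inΛY unitDistY
      (fun x => (opsYNuStOfRecordV4PE N θ Mstar 𝔯 (sectEStY_flat N θ Mstar) (rwEY_flat N θ Mstar) 𝔈 x).GivenBy3185)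
      (fun x => (opsYNuStOfRecordV4PE N θ Mstar 𝔯 (sectEStY_flat N θ Mstar) (rwEY_flat N θ Mstar) 𝔈 x).HasRWExpC) :=
  ⟨δ₀, 1, 1, hδ₀, one_pos, one_pos, fun x _ _ _ U _ _ =>
    ⟨givenBy3185stY_flat x _ U, hasRWExpCY_flat _ _ x U δ₀, fun y y' _ _ => by
      rw [opsYNuStOfRecordV4PE_Ck_ker_flat, abs_zero]
      exact mul_nonneg zero_le_one (Real.exp_nonneg _)⟩⟩

/-- the honesty guard at the plain star v4P instance. [cite: Balaban1985BackgroundPropagators, Thm 3.15 (3.185)–(3.187) p.432, bookkeeping] -/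
theorem t315_opsYStOfRecordV4PE_flat {δ₀ : ℝ} (hδ₀ : 0 < δ₀) :
    B9.Thm315FullPrinted c35Y geo9Y (bg9Y (Matrix (Fin N) (Fin N) ℂ) (specialUnitaryUnits (Fin N)))
      (fun x => (opsYStOfRecordV4PE N θ Mstar 𝔯 (sectEStY_flat N θ Mstar) (rwEY_flat N θ Mstar) 𝔈 x).Ck) inΛY unitDistY
      (fun x => (opsYStOfRecordV4PE N θ Mstar 𝔯 (sectEStY_flat N θ Mstar) (rwEY_flat N θ Mstar) 𝔈 x).GivenBy3185)
      (fun x => (opsYStOfRecordV4PE N θ Mstar 𝔯 (sectEStY_flat N θ Mstar) (rwEY_flat N θ Mstar) 𝔈 x).HasRWExpC) :=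
  (t315_opsYStOfRecordV4PE_iff_nu N θ Mstar 𝔯 _ _ 𝔈).2 (t315_opsYNuStOfRecordV4PE_flat N θ Mstar 𝔯 𝔈 hδ₀)

end Record

end Literature.MathematicalPhysics.QuantumFieldTheory.Balaban1983to89.Node00

end
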